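import Summits.QuantumFields.YangMills.Theorems.AlphaInputsT3ACv3ProfileRegionR3
import HarnessLib

/-!
# `AlphaInputsT3ACv3LocalSmallXOfLevels` — B1 plumbing row r-loop for 2′∕2′χ: **r3 ⇒ SEAM-BLIND SMALL LOOPS** — membership in the (68) multi-level regularity set
# `reg68LevelsSet k h` implies membership in the seam-blind small-loop class `localSmallT3X k h` on the record's coupling window — cell `ym3-torus`, width seat
# 19936-w6 (g2); LEAD ★w1-19936 g3 B1 PLAN v1 (5)

WHY.  LEAD's B1 LOCATE (HOME `ym-ust-19936-w1/B1-REGIONAL-THM1-LOCATE-w1-g3.md` §1): the data-side selection `InClassSelT3X` asks print's (42)-minimiser to lie in the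
seam-blind adapted class `𝒞_X(k,h,W) = localSmallT3X ∩ reg68LocalSet ∩ large67Set ∩ [ChargedT3 → top42Set ∩ reg68LevelsSet]` (`…v3AdaptedClassX`); the plumbing rows are
r-68a∕r-68b (print's (2)∕(8) ⇒ the two (68) sets) and r-loop (⇒ `localSmallT3X`).  THIS FILE closes r-loop FROM r-68b's OUTPUT ALONE: at a read bond `c` of level `s+1`
(both ends in `Λ_i(h)`, `s+1 ≤ i ≤ k`) the (0.4) loop variables of `(blockAvg ℰp)^s U` read only the level-`s` plaquettes whose corners have blocks in `{c₋, c₊}`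
(`BoxStokes.dist1_loopHol_le_twoBlock`, constant `((d+2)L)²/4`); by block saturation those plaquettes are among r3's read plaquettes `plaqsIn s (lam42 Ω(h) k i)` with
`i − s ≥ 1`, so r3 gives `|(blockAvg ℰp)^s U(∂q) − 1| ≤ C68·θ(K−i)·L^{−2(i−s)} ≤ C68·θ(K−i)/L²`, hence loops `≤ (25/4)·C68·θ(K−i) ≤ δ_SU(2)/2` on the record's window
(`b7WindowNear_T3` + `aj_T3_eq_θBal`).  No collar, no hull, no new estimate.

WHAT (def-free).  §1 ★ `twoBlock_corner_blocks` (generic torus: the two middle corners of a plaquette whose lower-left∕upper-right corners have blocks in `{c₋,c₊}` also do —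
the two-block box is a product set, `BoxStokes.blockOf_mem_pair_iff`) and ★ `AlphaInputsT3AC.twoBlock_plaq_mem_plaqsIn_lam42` (such a plaquette under a read bond of
`Λ_i(h)` is one of r3's read plaquettes); §2 ★★ `AlphaInputsT3AC.localSmallT3X_of_reg68LevelsSet` (window `(25/4)·C68·θ(K−i) ≤ δ/2` displayed), `AlphaInputsT3AC.loopWindow_T3`
(the window on the record), ★★ `AlphaInputsT3AC.reg68LevelsSet_subset_localSmallT3X` (hypothesis-free, every `k ≤ K`, every history), `AlphaInputsT3AC.mem_adaptedClassT3X_of_rows`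
(membership in `𝒞_X` from the four rows r-68a, r-67, (42), r3 alone); §3 ★ `AlphaInputsT3AC.localSmallT3X_of_plaqSmallOn_Omega`
— the same conclusion directly from print's fine regularity (2) on the regions `Ω_i(h)`, `i ≤ k` ([B4] Prop. 2 ON THE REGION, `BoxStokes.dist1_iter_blockAvg_lt_region`; window displayed),
independent of r-68b.

HONEST FRAMING.  Lattice bookkeeping over tree theorems; nothing of [B10]∕[7]∕[4]'s estimates is asserted beyond the tree's kernel Props. 1–2; the class of record, its
definitions and the registry are untouched (J r4); print's (42)-minimiser is NOT claimed to lie in `𝒞_X` here (that is B1 = LQB Thm 1 at the regional carrier, LEAD's memo).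
Count-neutral helper toward R3 2′∕2′χ (`stub_laneRecordsV3Chi`, item 19936 — NOT proved here); YM₃ on T³ = rung R3 (finite-torus SU(2)), not T⁴, not the continuum limit, not the
Clay problem; no mass gap is claimed.

References: T. Bałaban, Commun. Math. Phys. 98 (1985) 17–51 [Balaban1985Averaging] ((15) p.19, (19)–(20) p.21, Props. 1–2 (51)–(54) p.26); CMP 102 (1985) 255–275 [Balaban1985UV3]
((39)–(42) p.266, (68) p.273); CMP 102 (1985) 277–309 [Balaban1985Variational] ((2)+(8) pp.278–279); CMP 109 (1987) 249–301 [Balaban1987RG1] ((0.4) p.253).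
-/

set_option autoImplicit false

noncomputable section

/-! ## §1 Geometry: the plaquettes read by the (0.4) loops at a read bond are r3's read plaquettes -/

namespace Summit.QuantumFields.YangMills.Theorems

open Set
open scoped Matrix.Norms.L2Operator
open Literature.MathematicalPhysics.QuantumFieldTheory.Balaban1983to89
open Literature.MathematicalPhysics.QuantumFieldTheory.Balaban1983to89.ExpMeanLog (expMeanLogSU deltaSU)
open Literature.MathematicalPhysics.QuantumFieldTheory.Balaban1983to89.T3ContinuumYM3Torus
open Literature.MathematicalPhysics.QuantumFieldTheory.Balaban1983to89.T3UnitLawDensityEML (ℰp)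
open Literature.MathematicalPhysics.QuantumFieldTheory.Balaban1983to89.T3UnitScaleTilt (θBal)
open Literature.MathematicalPhysics.QuantumFieldTheory.Balaban1983to89.T3MinimiserStabilityReduction (θBal_pos)
open Literature.MathematicalPhysics.QuantumFieldTheory.Balaban1983to89.B10Eq38TorusDomains (plaqsIn toFine toFine_succ toFine_zero mem_plaqsIn_iff cornerSet)
open Literature.MathematicalPhysics.QuantumFieldTheory.Balaban1983to89.B10Eq42TorusConstraint (bondsIn lam42 mem_bondsIn_iff)
open Literature.MathematicalPhysics.QuantumFieldTheory.Balaban1985CMP102.Setting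
open Summit.QuantumFields.Balaban3D.Carriers
open Summit.QuantumFields.Balaban3D.Proofs.Primitives (AlphaConsts)
open Summit.QuantumFields.YangMills.Theorems.BalabanUVNodesN08AlphaProfileBuild (aj aj_pos)
open Literature.MathematicalPhysics.QuantumFieldTheory.Balaban1983to89.B6Ineq2142KLevelV1 (shift_apply_of_ne)

section Generic

variable {P : Params} {j : ℕ}

/-- **★ THE TWO MIDDLE CORNERS OF A TWO-BLOCK PLAQUETTE ARE TWO-BLOCK**: if the lower-left and the upper-right corner of a level-`j` plaquette `q` have their blocks among
`{c₋, c₊}` for a bond `c` of `T^{(j+1)}`, so do the corners `q₋ + e_μ`, `q₋ + e_ν` (each coordinate of a middle corner is a coordinate of one of the two extreme corners, and the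
two-block box is a product set, `BoxStokes.blockOf_mem_pair_iff`). [cite: Balaban1987RG1, (0.1)+(0.4) pp.251–253] -/
theorem twoBlock_corner_blocks (c : PBond P (j + 1)) (q : Plaq P j)
    (hLL : blockOf q.src = c.src ∨ blockOf q.src = c.tgt)
    (hUR : blockOf ((q.src.shift q.μ).shift q.ν) = c.src ∨ blockOf ((q.src.shift q.μ).shift q.ν) = c.tgt) :
    (blockOf (q.src.shift q.μ) = c.src ∨ blockOf (q.src.shift q.μ) = c.tgt) ∧
      (blockOf (q.src.shift q.ν) = c.src ∨ blockOf (q.src.shift q.ν) = c.tgt) := by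
  have hμν : q.μ ≠ q.ν := ne_of_lt q.hμν
  rw [BoxStokes.blockOf_mem_pair_iff] at hLL hUR
  simp only [mem_setOf_eq] at hLL hUR
  constructor
  · rw [BoxStokes.blockOf_mem_pair_iff]
    simp only [mem_setOf_eq]
    intro κ
    by_cases hκ : κ = q.μ
    · -- the `μ`-coordinate of `q₋ + e_μ` is that of the upper-right corner
      have e : ((q.src.shift q.μ).shift q.ν) κ = (q.src.shift q.μ) κ := by
        rw [hκ]; exact shift_apply_of_ne _ hμν
      rw [← e]; exact hUR κ
    · rw [shift_apply_of_ne _ hκ]; exact hLL κ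
  · rw [BoxStokes.blockOf_mem_pair_iff]
    simp only [mem_setOf_eq]
    intro κ
    by_cases hκ : κ = q.ν
    · -- the `ν`-coordinate of `q₋ + e_ν` is that of the upper-right corner
      have e : ((q.src.shift q.μ).shift q.ν) κ = (q.src.shift q.ν) κ := by
        subst hκ
        show Function.update (q.src.shift q.μ) q.ν ((q.src.shift q.μ) q.ν + 1) q.ν = Function.update q.src q.ν (q.src q.ν + 1) q.ν
        rw [Function.update_self, Function.update_self, shift_apply_of_ne _ hμν.symm]
      rw [← e]; exact hUR κ
    · rw [shift_apply_of_ne _ hκ]; exact hLL κ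

end Generic

section T3

variable {F : T3Family} {𝔠 : AlphaConsts F.L (suGroupModel 2).N} {γ : ℝ} {hγ : 0 < γ} {hγ1 : γ ≤ (min 𝔠.gamma0 1) ^ 2} {K : ℕ}

/-- **★ A TWO-BLOCK PLAQUETTE UNDER A READ BOND IS ONE OF r3's READ PLAQUETTES**: for a bond `c` of `T^{(s+1)}` with both ends in `lam42 Ω(h) k i` (`s + 1 ≤ i ≤ k ≤ K`), every
level-`s` plaquette whose lower-left and upper-right corners have their blocks among `{c₋, c₊}` has all four corners under `lam42 Ω(h) k i` — block saturation of the read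
regions (`mem_lam42_iff_of_coarsen_eq`). [cite: Balaban1985UV3, (39)–(42) p.266 + (68) p.273] -/
theorem AlphaInputsT3AC.twoBlock_plaq_mem_plaqsIn_lam42 {k : ℕ} (hk : k ≤ K) (h : Hist (F.P K) k) {s i : ℕ} (hsi : s + 1 ≤ i) (hik : i ≤ k)
    {c : PBond (F.P K) (s + 1)}
    (hc : c ∈ bondsIn (s + 1) (lam42 (Omega 𝔠.lane.carrier.M₁ (rcolOf (T3Scales F γ hγ (hγ1.trans (sq_min_one_le _ 𝔠.gamma0_pos)) K) 𝔠.lane.carrier) k h) k i))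
    {q : Plaq (F.P K) s} (hLL : blockOf q.src = c.src ∨ blockOf q.src = c.tgt)
    (hUR : blockOf ((q.src.shift q.μ).shift q.ν) = c.src ∨ blockOf ((q.src.shift q.μ).shift q.ν) = c.tgt) :
    q ∈ plaqsIn s (lam42 (Omega 𝔠.lane.carrier.M₁ (rcolOf (T3Scales F γ hγ (hγ1.trans (sq_min_one_le _ 𝔠.gamma0_pos)) K) 𝔠.lane.carrier) k h) k i) := by
  have hs1 : s + 1 ≤ (F.P K).m + (F.P K).K := (hsi.trans hik).trans (AlphaInputsT3AC.le_standing_of_le hk)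
  have hs0 : s ≤ (F.P K).m + (F.P K).K := (Nat.le_succ s).trans hs1
  obtain ⟨hμ, hν⟩ := twoBlock_corner_blocks c q hLL hUR
  -- a level-`s` site whose block is an end of `c` lies under the read region
  have mem_of : ∀ z : Site (F.P K) s, (blockOf z = c.src ∨ blockOf z = c.tgt) →
      toFine s z ∈ lam42 (Omega 𝔠.lane.carrier.M₁ (rcolOf (T3Scales F γ hγ (hγ1.trans (sq_min_one_le _ 𝔠.gamma0_pos)) K) 𝔠.lane.carrier) k h) k i := by
    intro z hz
    have key : ∀ y : Site (F.P K) (s + 1), blockOf z = y → coarsen (s + 1) (toFine s z) = coarsen (s + 1) (toFine (s + 1) y) := by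
      intro y hzy
      rw [coarsen_succ, coarsen_toFine s hs0, hzy, coarsen_toFine (s + 1) hs1]
    rcases hz with hz | hz
    · exact (mem_lam42_iff_of_coarsen_eq _ _ h hsi hik (key c.src hz)).mpr hc.1
    · exact (mem_lam42_iff_of_coarsen_eq _ _ h hsi hik (key c.tgt hz)).mpr hc.2
  rw [mem_plaqsIn_iff]
  intro x hx
  simp only [cornerSet, mem_insert_iff, mem_singleton_iff] at hx
  rcases hx with rfl | rfl | rfl | rfl
  · exact mem_of _ hLL
  · exact mem_of _ hμ
  · exact mem_of _ hν
  · exact mem_of _ hUR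

/-! ## §2 r3 ⇒ seam-blind small loops -/

/-- **★★ r-loop FROM r3 (window displayed)**: a finest-lattice configuration in the (68) multi-level regularity set `reg68LevelsSet k h` (`k ≤ K`) lies in the seam-blind small-loop
class `localSmallT3X k h` as soon as `(25/4)·C68·θ(K−i) ≤ δ_SU(2)/2` for every `i ≤ k` — the (0.4) loop variables at a read bond of level `s+1` under `Λ_i(h)` are controlled by
r3's read plaquettes of level `s` under `Λ_i(h)`, `i − s ≥ 1` (`BoxStokes.dist1_loopHol_le_twoBlock`, `twoBlock_plaq_mem_plaqsIn_lam42`).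
[cite: Balaban1985Averaging, (19)–(20) p.21; Balaban1985UV3, (68) p.273; Balaban1987RG1, (0.4) p.253] -/
theorem AlphaInputsT3AC.localSmallT3X_of_reg68LevelsSet {k : ℕ} (hk : k ≤ K) (h : Hist (F.P K) k)
    (hwin : ∀ i, i ≤ k → (25 / 4 : ℝ) * (𝔠.C68 * θBal F.L γ 𝔠.b₀ 𝔠.p₀ (K - i)) ≤ ℰp.δ / 2)
    {U : GaugeField (F.P K) 0 (Matrix.specialUnitaryGroup (Fin 2) ℂ)} (hU : U ∈ AlphaInputsT3AC.reg68LevelsSet F 𝔠 γ hγ hγ1 K k h) :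
    U ∈ AlphaInputsT3AC.localSmallT3X F 𝔠 γ hγ hγ1 K k h := by
  rw [AlphaInputsT3AC.mem_localSmallT3X_iff]
  intro s hs c hc x
  obtain ⟨i, hsi, hik, hcb⟩ := hc
  have hs1 : s + 1 ≤ (F.P K).m + (F.P K).K := (hsi.trans hik).trans (AlphaInputsT3AC.le_standing_of_le hk)
  have hL1 : (1 : ℝ) ≤ F.L := by exact_mod_cast le_of_lt F.hL.2
  have hL0 : (0 : ℝ) < F.L := by linarith
  have hγone : γ ≤ 1 := hγ1.trans (sq_min_one_le _ 𝔠.gamma0_pos)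
  set θ : ℝ := 𝔠.C68 * θBal F.L γ 𝔠.b₀ 𝔠.p₀ (K - i) with hθ
  have hθ0 : 0 ≤ θ :=
    mul_nonneg 𝔠.C68_pos.le (θBal_pos (by exact_mod_cast le_of_lt F.hL.2) hγ hγone 𝔠.b₀_pos 𝔠.p₀ (K - i)).le
  set δs : ℝ := θ * (((F.L : ℝ) ^ (i - s))⁻¹) ^ 2 with hδs
  have hδs0 : 0 ≤ δs := by positivity
  -- r3 on the two-block plaquettes of `c`
  have hplaq : ∀ q : Plaq (F.P K) s, (blockOf q.src = c.src ∨ blockOf q.src = c.tgt) →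
      (blockOf ((q.src.shift q.μ).shift q.ν) = c.src ∨ blockOf ((q.src.shift q.μ).shift q.ν) = c.tgt) →
      dist1 (GaugeField.plaqHol (Averaging.iter (fun l => (BlockAveraging.blockAvg ℰp : Averaging (F.P K) l _)) s U) q) ≤ δs :=
    fun q h1 h2 => hU i hik s (by omega) q (AlphaInputsT3AC.twoBlock_plaq_mem_plaqsIn_lam42 (𝔠 := 𝔠) (hγ1 := hγ1) hk h hsi hik hcb h1 h2)
  refine (BoxStokes.dist1_loopHol_le_twoBlock hs1 hδs0 c hplaq x).trans ?_
  -- `((d+2)L)²/4 · θ·L^{−2(i−s)} ≤ (25/4)·θ` since `i − s ≥ 1`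
  have hd : ((F.P K).d + 2) * (F.P K).L = (3 + 2) * F.L := rfl
  rw [hd]
  have hcast : ((((3 + 2) * F.L : ℕ) : ℝ)) = 5 * (F.L : ℝ) := by push_cast; ring
  rw [hcast]
  have hratio : (F.L : ℝ) * ((F.L : ℝ) ^ (i - s))⁻¹ ≤ 1 := by
    rw [mul_inv_le_iff₀ (pow_pos hL0 _), one_mul]
    calc (F.L : ℝ) = (F.L : ℝ) ^ 1 := (pow_one _).symm
      _ ≤ (F.L : ℝ) ^ (i - s) := pow_le_pow_right₀ hL1 (by omega)
  have hratio0 : 0 ≤ (F.L : ℝ) * ((F.L : ℝ) ^ (i - s))⁻¹ := by positivity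
  calc (5 * (F.L : ℝ)) ^ 2 / 4 * δs = (25 / 4 : ℝ) * θ * ((F.L : ℝ) * ((F.L : ℝ) ^ (i - s))⁻¹) ^ 2 := by rw [hδs]; ring
    _ ≤ (25 / 4 : ℝ) * θ * 1 := by
        refine mul_le_mul_of_nonneg_left ?_ (by positivity)
        nlinarith
    _ = (25 / 4 : ℝ) * (𝔠.C68 * θBal F.L γ 𝔠.b₀ 𝔠.p₀ (K - i)) := by rw [hθ]; ring
    _ ≤ ℰp.δ / 2 := hwin i hik

include hγ hγ1 in
/-- **THE LOOP WINDOW ON THE RECORD'S COUPLING WINDOW**: `(25/4)·C68·θ(K−i) ≤ δ_SU(2)/2` for every `i ≤ K` (`a_i = θ(K−i)` by `aj_T3_eq_θBal`; `b7WindowNear_T3`'s third clause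
`((5L)²/4)·(C68·a_i + 2C₀(3)(C68·a_i)²) ≤ δ_SU(2)/2` and `25/4 ≤ 25L²/4`). [cite: Balaban1985Averaging, Prop. 2 (54) p.26; Balaban1985UV3, (7) p.257] -/
theorem AlphaInputsT3AC.loopWindow_T3 {i : ℕ} (hi : i ≤ K) :
    (25 / 4 : ℝ) * (𝔠.C68 * θBal F.L γ 𝔠.b₀ 𝔠.p₀ (K - i)) ≤ ℰp.δ / 2 := by
  obtain ⟨hα, -, -, h3⟩ := AlphaInputsT3AC.b7WindowNear_T3 (F := F) (𝔠 := 𝔠) (γ := γ) (hγ := hγ) (hγ1 := hγ1) (K := K) hi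
  rw [AlphaInputsT3AC.aj_T3_eq_θBal (𝔠 := 𝔠) (hγ := hγ) (hγ1 := hγ1) hi] at hα h3
  set α : ℝ := 𝔠.C68 * θBal F.L γ 𝔠.b₀ 𝔠.p₀ (K - i) with hαdef
  have hL1 : (1 : ℝ) ≤ F.L := by exact_mod_cast le_of_lt F.hL.2
  have hcast : ((((3 + 2) * F.L : ℕ) : ℝ)) ^ 2 / 4 = (25 / 4 : ℝ) * (F.L : ℝ) ^ 2 := by push_cast; ring
  rw [hcast] at h3
  show (25 / 4 : ℝ) * α ≤ deltaSU (Fin 2) / 2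
  have hC : (0 : ℝ) ≤ 2 * (143 * ((((3 + 4 : ℕ) : ℝ)) ^ 2 / 4) ^ 2) * α ^ 2 := by positivity
  have hL2 : (1 : ℝ) ≤ (F.L : ℝ) ^ 2 := by nlinarith
  calc (25 / 4 : ℝ) * α ≤ (25 / 4 : ℝ) * (F.L : ℝ) ^ 2 * α := by nlinarith
    _ ≤ (25 / 4 : ℝ) * (F.L : ℝ) ^ 2 * (α + 2 * (143 * ((((3 + 4 : ℕ) : ℝ)) ^ 2 / 4) ^ 2) * α ^ 2) := by
        refine mul_le_mul_of_nonneg_left (by linarith) (by positivity)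
    _ ≤ deltaSU (Fin 2) / 2 := h3

/-- **★★ r3 ⇒ SEAM-BLIND SMALL LOOPS, ON THE RECORD** (`k ≤ K`, every history, no further hypothesis): `reg68LevelsSet k h ⊆ localSmallT3X k h` — B1's plumbing row r-loop is ONE
`exact` after r-68b; for a CHARGED datum the `localSmallT3X` conjunct of `𝒞_X(k,h,W)` is implied by its r3 conjunct.
[cite: Balaban1985UV3, (42) p.266 + (68) p.273; Balaban1987RG1, (0.4) p.253] -/
theorem AlphaInputsT3AC.reg68LevelsSet_subset_localSmallT3X {k : ℕ} (hk : k ≤ K) (h : Hist (F.P K) k) :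
    AlphaInputsT3AC.reg68LevelsSet F 𝔠 γ hγ hγ1 K k h ⊆ AlphaInputsT3AC.localSmallT3X F 𝔠 γ hγ hγ1 K k h :=
  fun _ hU => AlphaInputsT3AC.localSmallT3X_of_reg68LevelsSet (𝔠 := 𝔠) (hγ1 := hγ1) hk h
    (fun _ hik => AlphaInputsT3AC.loopWindow_T3 (𝔠 := 𝔠) (hγ := hγ) (hγ1 := hγ1) (hik.trans hk)) hU

/-- **MEMBERSHIP IN `𝒞_X(k,h,W)` FROM THE FOUR ROWS r-68a, r-67, (42), r3** (`k ≤ K`): the small-loop conjunct is implied by r3 (`reg68LevelsSet_subset_localSmallT3X`), so B1's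
«print's minimiser ∈ 𝒞_X» needs exactly `reg68LocalSet`, `large67Set`, `top42Set`, `reg68LevelsSet` (the last two then hold whether or not the datum is charged).  An observation about
the class of record; no definition is changed. [cite: Balaban1985UV3, (42) p.266 + (67)–(68) p.273] -/
theorem AlphaInputsT3AC.mem_adaptedClassT3X_of_rows {k : ℕ} (hk : k ≤ K) {h : Hist (F.P K) k}
    {W : GaugeField (F.P K) k (Matrix.specialUnitaryGroup (Fin 2) ℂ)}
    {U : GaugeField (F.P K) 0 (Matrix.specialUnitaryGroup (Fin 2) ℂ)}
    (hR : U ∈ AlphaInputsT3AC.reg68LocalSet F 𝔠 γ hγ hγ1 K k h) (hL : U ∈ AlphaInputsT3AC.large67Set F 𝔠 γ hγ hγ1 K k h)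
    (h42 : U ∈ AlphaInputsT3AC.top42Set F 𝔠 γ hγ hγ1 K k h W) (h68 : U ∈ AlphaInputsT3AC.reg68LevelsSet F 𝔠 γ hγ hγ1 K k h) :
    U ∈ AlphaInputsT3AC.adaptedClassT3X F 𝔠 γ hγ hγ1 K k h W :=
  ⟨AlphaInputsT3AC.reg68LevelsSet_subset_localSmallT3X (𝔠 := 𝔠) (hγ1 := hγ1) hk h h68, hR, hL, fun _ => ⟨h42, h68⟩⟩

/-! ## §3 The same from print's fine regularity (2) on the regions, independently of r-68b -/

/-- **★ r-loop FROM FINE REGULARITY ON THE REGIONS** (`k ≤ K`; window displayed): if the FINE plaquettes of `U` with all four corners in `Ω_i(h)` are `α₀·(L^i)⁻²`-small for every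
`i ≤ k` (print's (2)∕(8), clause 1, read on `plaqsIn 0 Ω_i(h)`), with `α₀` in [B4] Prop. 2's window at `d = 3`, `N = 2` and `(25/2)·α₀ ≤ δ_SU(2)/2`, then `U ∈ localSmallT3X k h`:
Prop. 2 ON THE REGION under `lam42 Ω(h) k i` (`BoxStokes.dist1_iter_blockAvg_lt_region`, nested family `regionSites`) bounds r3's read plaquettes of level `s` by `2α₀·(L^s/L^i)²
≤ 2α₀/L²`, and the two-block Stokes bound gives loops `≤ (25L²/4)·2α₀/L² = (25/2)·α₀`.  No collar. [cite: Balaban1985Averaging, Prop. 2 (52)–(54) p.26 + (19)–(20) p.21; Balaban1985Variational, (2)+(8) pp.278–279] -/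
theorem AlphaInputsT3AC.localSmallT3X_of_plaqSmallOn_Omega {k : ℕ} (hk : k ≤ K) (h : Hist (F.P K) k) {α₀ : ℝ} (hα : 0 < α₀)
    (hα3 : (143 * ((((3 + 4 : ℕ) : ℝ)) ^ 2 / 4) ^ 2) * α₀ ≤ 1 / 3)
    (hα2 : 2 * α₀ ≤ 2 * deltaSU (Fin 2) / (((3 + 4) * F.L : ℕ) : ℝ) ^ 2)
    (hδ : (25 / 2 : ℝ) * α₀ ≤ ℰp.δ / 2)
    {U : GaugeField (F.P K) 0 (Matrix.specialUnitaryGroup (Fin 2) ℂ)}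
    (hU : ∀ i, i ≤ k → PlaqSmallOn (↑(plaqsIn 0 (Omega 𝔠.lane.carrier.M₁
        (rcolOf (T3Scales F γ hγ (hγ1.trans (sq_min_one_le _ 𝔠.gamma0_pos)) K) 𝔠.lane.carrier) k h i)) : Set (Plaq (F.P K) 0))
      (α₀ * (((F.L : ℝ) ^ i)⁻¹) ^ 2) U) :
    U ∈ AlphaInputsT3AC.localSmallT3X F 𝔠 γ hγ hγ1 K k h := by
  rw [AlphaInputsT3AC.mem_localSmallT3X_iff]
  intro s hs c hc x
  obtain ⟨i, hsi, hik, hcb⟩ := hc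
  have hs1 : s + 1 ≤ (F.P K).m + (F.P K).K := (hsi.trans hik).trans (AlphaInputsT3AC.le_standing_of_le hk)
  have hi_std : i ≤ (F.P K).m + (F.P K).K := hik.trans (AlphaInputsT3AC.le_standing_of_le hk)
  have hL1 : (1 : ℝ) ≤ F.L := by exact_mod_cast le_of_lt F.hL.2
  have hL0 : (0 : ℝ) < F.L := by linarith
  have hα3' : (143 * (((((F.P K).d + 4 : ℕ) : ℝ)) ^ 2 / 4) ^ 2) * α₀ ≤ 1 / 3 := by
    have hd : (F.P K).d + 4 = 3 + 4 := rfl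
    rw [hd]; exact hα3
  have hα2' : 2 * α₀ ≤ 2 * deltaSU (Fin 2) / ((((F.P K).d + 4) * (F.P K).L : ℕ) : ℝ) ^ 2 := by
    have hd : ((F.P K).d + 4) * (F.P K).L = (3 + 4) * F.L := rfl
    rw [hd]; exact hα2
  -- (52) on the fine sites under the read region, from (2) on `Ω_i(h) ⊇ lam42 Ω(h) k i`
  have h52 : ∀ q₀ : Plaq (F.P K) 0, q₀.src ∈ AlphaInputsT3AC.regionSites (𝔠 := 𝔠) (hγ := hγ) (hγ1 := hγ1) k h i 0 →
      q₀.src.shift q₀.μ ∈ AlphaInputsT3AC.regionSites (𝔠 := 𝔠) (hγ := hγ) (hγ1 := hγ1) k h i 0 →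
      q₀.src.shift q₀.ν ∈ AlphaInputsT3AC.regionSites (𝔠 := 𝔠) (hγ := hγ) (hγ1 := hγ1) k h i 0 →
      (q₀.src.shift q₀.μ).shift q₀.ν ∈ AlphaInputsT3AC.regionSites (𝔠 := 𝔠) (hγ := hγ) (hγ1 := hγ1) k h i 0 →
      dist1 (GaugeField.plaqHol U q₀) < α₀ * (((F.L : ℝ) ^ i)⁻¹) ^ 2 := by
    intro q₀ h0 h1 h2 h3
    refine hU i hik q₀ (Finset.mem_coe.mpr (mem_plaqsIn_iff.mpr ?_))
    have hsub := lam42_subset_of_le (Omega 𝔠.lane.carrier.M₁ (rcolOf (T3Scales F γ hγ (hγ1.trans (sq_min_one_le _ 𝔠.gamma0_pos)) K) 𝔠.lane.carrier) k h) hik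
    intro y hy
    simp only [cornerSet, toFine_zero, mem_insert_iff, mem_singleton_iff] at hy
    rcases hy with rfl | rfl | rfl | rfl
    · exact hsub h0
    · exact hsub h1
    · exact hsub h2
    · exact hsub h3
  -- the two-block plaquettes of `c` are under the region; Prop. 2 on the region bounds them
  have hplaq : ∀ q : Plaq (F.P K) s, (blockOf q.src = c.src ∨ blockOf q.src = c.tgt) →
      (blockOf ((q.src.shift q.μ).shift q.ν) = c.src ∨ blockOf ((q.src.shift q.μ).shift q.ν) = c.tgt) →
      dist1 (GaugeField.plaqHol (Averaging.iter (fun l => (BlockAveraging.blockAvg ℰp : Averaging (F.P K) l _)) s U) q) ≤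
        2 * α₀ * ((F.L : ℝ) ^ s * ((F.L : ℝ) ^ i)⁻¹) ^ 2 := by
    intro q h1 h2
    have hq := AlphaInputsT3AC.twoBlock_plaq_mem_plaqsIn_lam42 (𝔠 := 𝔠) (hγ1 := hγ1) hk h hsi hik hcb h1 h2
    have hc4 := mem_plaqsIn_iff.mp hq
    have e1 : q.src ∈ AlphaInputsT3AC.regionSites (𝔠 := 𝔠) (hγ := hγ) (hγ1 := hγ1) k h i s := hc4 (by simp [cornerSet])
    have e2 : q.src.shift q.μ ∈ AlphaInputsT3AC.regionSites (𝔠 := 𝔠) (hγ := hγ) (hγ1 := hγ1) k h i s := hc4 (by simp [cornerSet])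
    have e3 : q.src.shift q.ν ∈ AlphaInputsT3AC.regionSites (𝔠 := 𝔠) (hγ := hγ) (hγ1 := hγ1) k h i s := hc4 (by simp [cornerSet])
    have e4 : (q.src.shift q.μ).shift q.ν ∈ AlphaInputsT3AC.regionSites (𝔠 := 𝔠) (hγ := hγ) (hγ1 := hγ1) k h i s := hc4 (by simp [cornerSet])
    exact le_of_lt (BoxStokes.dist1_iter_blockAvg_lt_region (n := Fin 2) i hi_std hα hα3' hα2'
      (AlphaInputsT3AC.regionSites (𝔠 := 𝔠) (hγ := hγ) (hγ1 := hγ1) k h i)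
      (AlphaInputsT3AC.regionSites_nested (𝔠 := 𝔠) (hγ1 := hγ1) hk h hik) (U := U) h52 (by omega) q e1 e2 e3 e4)
  have hδs0 : 0 ≤ 2 * α₀ * ((F.L : ℝ) ^ s * ((F.L : ℝ) ^ i)⁻¹) ^ 2 := by positivity
  refine (BoxStokes.dist1_loopHol_le_twoBlock hs1 hδs0 c hplaq x).trans ?_
  have hd : ((F.P K).d + 2) * (F.P K).L = (3 + 2) * F.L := rfl
  rw [hd]
  have hcast : ((((3 + 2) * F.L : ℕ) : ℝ)) = 5 * (F.L : ℝ) := by push_cast; ring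
  rw [hcast]
  -- `L · L^s / L^i ≤ 1` since `i ≥ s + 1`
  have hratio : (F.L : ℝ) * ((F.L : ℝ) ^ s * ((F.L : ℝ) ^ i)⁻¹) ≤ 1 := by
    rw [← mul_assoc, ← pow_succ', mul_inv_le_iff₀ (pow_pos hL0 _), one_mul]
    exact pow_le_pow_right₀ hL1 hsi
  have hratio0 : 0 ≤ (F.L : ℝ) * ((F.L : ℝ) ^ s * ((F.L : ℝ) ^ i)⁻¹) := by positivity
  calc (5 * (F.L : ℝ)) ^ 2 / 4 * (2 * α₀ * ((F.L : ℝ) ^ s * ((F.L : ℝ) ^ i)⁻¹) ^ 2)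
      = (25 / 2 : ℝ) * α₀ * ((F.L : ℝ) * ((F.L : ℝ) ^ s * ((F.L : ℝ) ^ i)⁻¹)) ^ 2 := by ring
    _ ≤ (25 / 2 : ℝ) * α₀ * 1 := by
        refine mul_le_mul_of_nonneg_left ?_ (by positivity)
        nlinarith
    _ = (25 / 2 : ℝ) * α₀ := by ring
    _ ≤ ℰp.δ / 2 := hδ

end T3

end Summit.QuantumFields.YangMills.Theorems

end
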